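import Summits.RiemannHypothesis.RiemannHypothesis.Theorems.GroundBartaEvenWinsBeyondArchDeflationOutsideImage
import HarnessLib

/-!
# RiemannHypothesis / GroundBarta — rung 4 (`EvenWinsBeyondArch`, stmt-RiemannHypothesis-18807 / 18085):
# the window image of an edge-vanishing trial vector outside its support — parity and the uniform sliver bound

Helper file (`--supports stmt-RiemannHypothesis-18085`), RH-free, Mathlib + landed tree files only, no definitions,
no named facts.  Prover A (g10 of unit `sr-gb-rung-a`), endpoint cell `(log 5)/2`.

Sequel of `…DeflationOutsideImage` (`dt_outsideImage_sub_le`: the variation of the bare image `T` of a bounded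
Lipschitz vector `v` supported in `[-c', c']` on `c' < y ≤ 1`).  Here:

* `dt_outsideImage_reflect` — `T(-y) = σ T(y)` when `v(-x) = σ v(x)` (pole coefficients `(1−σ)∫v ch = 0`,
  `(1+σ)∫v sh = 0` by the substitution `x ↦ -x`);
* `dt_outsideImage_norm_le` — the UNIFORM bound on the two-sided sliver: for `σ = ±1`, `‖T(c')‖ ≤ τ` and
  `c' < b⁺ ≤ 1`, every `y` with `c' < |y| ≤ b⁺` has
  `‖T(y)‖ ≤ τ + (b⁺ − c')·(12G₀ + Λ_I L + L(1 + C₁) + (3/4)L(1 − log(b⁺ − c')))`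
  (`d(−log d) ≤ D(1 − log D)` for `0 < d ≤ D ≤ 1`, from `log x ≤ x − 1`).
-/

set_option linter.dupNamespace false

noncomputable section

open MeasureTheory Set Filter
open scoped Topology ENNReal NNReal ComplexConjugate BigOperators

namespace Summit.RiemannHypothesis.RiemannHypothesis.Theorems.EvenWinsBeyondArch

open Literature.NumberTheory.LFunctions

/-- **Parity of the bare image.**  If `v(-x) = σ v(x)` for all `x`, then `T(-y) = σ T(y)` for the bare image `T` of
`dt_outsideImage_sub_le`. [folklore] -/
theorem dt_outsideImage_reflect (σ : ℝ) {v : ℝ → ℂ} (hvσ : ∀ x, v (-x) = (σ : ℂ) * v x)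
    (I : Finset ℕ) {T : ℝ → ℂ}
    (hT : ∀ y, T y = 2 * (∫ x, v x * (Real.cosh (x / 2) : ℂ)) * (Real.cosh (y / 2) : ℂ) -
        2 * (∫ x, v x * (Real.sinh (x / 2) : ℂ)) * (Real.sinh (y / 2) : ℂ) +
      (∑ n ∈ I, (((ArithmeticFunction.vonMangoldt n : ℝ) / Real.sqrt n : ℝ) : ℂ) *
        (2 * v y - v (y - Real.log n) - v (y + Real.log n))) +
      ∫ t in Ioi 0, (weilArchDensity t : ℂ) * (2 * v y - v (y - t) - v (y + t)))
    (y : ℝ) : T (-y) = (σ : ℂ) * T y := by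
  -- the pole coefficients under the reflection `x ↦ -x`
  have hc : (∫ x, v x * (Real.cosh (x / 2) : ℂ)) = (σ : ℂ) * ∫ x, v x * (Real.cosh (x / 2) : ℂ) := by
    calc (∫ x, v x * (Real.cosh (x / 2) : ℂ)) = ∫ x, v (-x) * (Real.cosh (-x / 2) : ℂ) :=
          (integral_neg_eq_self (fun x ↦ v x * (Real.cosh (x / 2) : ℂ)) volume).symm
      _ = ∫ x, (σ : ℂ) * (v x * (Real.cosh (x / 2) : ℂ)) := by
          refine integral_congr_ae (Eventually.of_forall fun x ↦ ?_)
          simp only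
          rw [hvσ x, neg_div, Real.cosh_neg]; ring
      _ = (σ : ℂ) * ∫ x, v x * (Real.cosh (x / 2) : ℂ) := integral_const_mul _ _
  have hs : (∫ x, v x * (Real.sinh (x / 2) : ℂ)) = -((σ : ℂ) * ∫ x, v x * (Real.sinh (x / 2) : ℂ)) := by
    calc (∫ x, v x * (Real.sinh (x / 2) : ℂ)) = ∫ x, v (-x) * (Real.sinh (-x / 2) : ℂ) :=
          (integral_neg_eq_self (fun x ↦ v x * (Real.sinh (x / 2) : ℂ)) volume).symm
      _ = ∫ x, (-(σ : ℂ)) * (v x * (Real.sinh (x / 2) : ℂ)) := by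
          refine integral_congr_ae (Eventually.of_forall fun x ↦ ?_)
          simp only
          rw [hvσ x, neg_div, Real.sinh_neg]; push_cast; ring
      _ = -((σ : ℂ) * ∫ x, v x * (Real.sinh (x / 2) : ℂ)) := by rw [integral_const_mul]; ring
  -- the prime and archimedean layers
  have hprime : (∑ n ∈ I, (((ArithmeticFunction.vonMangoldt n : ℝ) / Real.sqrt n : ℝ) : ℂ) *
      (2 * v (-y) - v (-y - Real.log n) - v (-y + Real.log n))) =
      (σ : ℂ) * ∑ n ∈ I, (((ArithmeticFunction.vonMangoldt n : ℝ) / Real.sqrt n : ℝ) : ℂ) *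
        (2 * v y - v (y - Real.log n) - v (y + Real.log n)) := by
    rw [Finset.mul_sum]
    refine Finset.sum_congr rfl fun n _ ↦ ?_
    rw [show -y - Real.log n = -(y + Real.log n) by ring, show -y + Real.log n = -(y - Real.log n) by ring,
      hvσ, hvσ, hvσ]
    ring
  have harch : (∫ t in Ioi 0, (weilArchDensity t : ℂ) * (2 * v (-y) - v (-y - t) - v (-y + t))) =
      (σ : ℂ) * ∫ t in Ioi 0, (weilArchDensity t : ℂ) * (2 * v y - v (y - t) - v (y + t)) := by
    rw [← integral_const_mul]
    refine integral_congr_ae (Eventually.of_forall fun t ↦ ?_)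
    simp only
    rw [show -y - t = -(y + t) by ring, show -y + t = -(y - t) by ring, hvσ, hvσ, hvσ]
    ring
  -- the pole layer
  have key : 2 * (∫ x, v x * (Real.cosh (x / 2) : ℂ)) * (Real.cosh (y / 2) : ℂ) -
      2 * (∫ x, v x * (Real.sinh (x / 2) : ℂ)) * -(Real.sinh (y / 2) : ℂ) =
      (σ : ℂ) * (2 * (∫ x, v x * (Real.cosh (x / 2) : ℂ)) * (Real.cosh (y / 2) : ℂ) -
        2 * (∫ x, v x * (Real.sinh (x / 2) : ℂ)) * (Real.sinh (y / 2) : ℂ)) := by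
    have e1 : 2 * (∫ x, v x * (Real.cosh (x / 2) : ℂ)) * (Real.cosh (y / 2) : ℂ) =
        (σ : ℂ) * (2 * (∫ x, v x * (Real.cosh (x / 2) : ℂ)) * (Real.cosh (y / 2) : ℂ)) := by
      conv_lhs => rw [hc]
      ring
    have e2 : 2 * (∫ x, v x * (Real.sinh (x / 2) : ℂ)) * -(Real.sinh (y / 2) : ℂ) =
        (σ : ℂ) * (2 * (∫ x, v x * (Real.sinh (x / 2) : ℂ)) * (Real.sinh (y / 2) : ℂ)) := by
      conv_lhs => rw [hs]
      ring
    linear_combination e1 - e2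
  rw [hT (-y), hT y, hprime, harch, neg_div, Real.cosh_neg, Real.sinh_neg, Complex.ofReal_neg, key]
  ring

/-- **The uniform bound on the sliver.**  Under the hypotheses of `dt_outsideImage_sub_le`, if moreover
`v(-x) = σ v(x)` with `σ = ±1`, `‖T(c')‖ ≤ τ` and `c' < b⁺ ≤ 1`, then for every `y` with `c' < |y| ≤ b⁺`:
`‖T(y)‖ ≤ τ + (b⁺ − c')·(12G₀ + Λ_I L + L(1 + C₁) + (3/4)L(1 − log(b⁺ − c')))`. [folklore] -/
theorem dt_outsideImage_norm_le {c' : ℝ} (hc' : 0 < c') {v : ℝ → ℂ} (hvm : Measurable v) {G₀ L : ℝ}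
    (hG₀ : ∀ z, ‖v z‖ ≤ G₀) (hL : ∀ a b, ‖v a - v b‖ ≤ L * |a - b|) (hvs : ∀ z, z ∉ Icc (-c') c' → v z = 0)
    (σ : ℝ) (hσ : σ = 1 ∨ σ = -1) (hvσ : ∀ x, v (-x) = (σ : ℂ) * v x)
    (I : Finset ℕ) {T : ℝ → ℂ}
    (hT : ∀ y, T y = 2 * (∫ x, v x * (Real.cosh (x / 2) : ℂ)) * (Real.cosh (y / 2) : ℂ) -
        2 * (∫ x, v x * (Real.sinh (x / 2) : ℂ)) * (Real.sinh (y / 2) : ℂ) +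
      (∑ n ∈ I, (((ArithmeticFunction.vonMangoldt n : ℝ) / Real.sqrt n : ℝ) : ℂ) *
        (2 * v y - v (y - Real.log n) - v (y + Real.log n))) +
      ∫ t in Ioi 0, (weilArchDensity t : ℂ) * (2 * v y - v (y - t) - v (y + t)))
    {τ : ℝ} (hτ : ‖T c'‖ ≤ τ) {bp : ℝ} (hbp : c' < bp) (hbp1 : bp ≤ 1)
    {y : ℝ} (hy : c' < |y|) (hyb : |y| ≤ bp) :
    ‖T y‖ ≤ τ + (bp - c') * (12 * G₀ + (∑ n ∈ I, (ArithmeticFunction.vonMangoldt n : ℝ) / Real.sqrt n) * L +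
        L * (1 + ∫ t in Ici (1 : ℝ), weilArchDensity t) + 3 / 4 * L * (1 - Real.log (bp - c'))) := by
  have hG₀0 : 0 ≤ G₀ := (norm_nonneg _).trans (hG₀ 0)
  have hL0 : 0 ≤ L := by
    have h := hL 1 0; rw [sub_zero, abs_one, mul_one] at h; exact (norm_nonneg _).trans h
  have hΛ0 : 0 ≤ ∑ n ∈ I, (ArithmeticFunction.vonMangoldt n : ℝ) / Real.sqrt n :=
    Finset.sum_nonneg fun n _ ↦ div_nonneg ArithmeticFunction.vonMangoldt_nonneg (Real.sqrt_nonneg _)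
  have hC0 : 0 ≤ ∫ t in Ici (1 : ℝ), weilArchDensity t :=
    setIntegral_nonneg measurableSet_Ici fun t (ht : 1 ≤ t) ↦ (weilArchDensity_pos (by linarith)).le
  set D : ℝ := bp - c' with hD
  have hD0 : 0 < D := by rw [hD]; linarith
  have hD1 : D ≤ 1 := by rw [hD]; linarith
  have hlogD : 0 ≤ -Real.log D := by have := Real.log_nonpos hD0.le hD1; linarith
  set V : ℝ := 12 * G₀ + (∑ n ∈ I, (ArithmeticFunction.vonMangoldt n : ℝ) / Real.sqrt n) * L +
    L * (1 + ∫ t in Ici (1 : ℝ), weilArchDensity t) with hV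
  have hV0 : 0 ≤ V := by rw [hV]; positivity
  -- the bound at a point of the right sliver
  have hright : ∀ z, c' < z → z ≤ bp → ‖T z‖ ≤ τ + D * (V + 3 / 4 * L * (1 - Real.log D)) := by
    intro z hz hzb
    have hz1 : z ≤ 1 := hzb.trans hbp1
    have hsub := dt_outsideImage_sub_le hc' hvm hG₀ hL hvs I hT hz hz1
    set d : ℝ := z - c' with hd
    have hd0 : 0 < d := by rw [hd]; linarith
    have hdD : d ≤ D := by rw [hd, hD]; linarith
    -- `d(−log d) ≤ D(1 − log D)`
    have hlog : d * (-Real.log d) ≤ D * (1 - Real.log D) := by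
      have h1 : Real.log (D / d) ≤ D / d - 1 := Real.log_le_sub_one_of_pos (by positivity)
      have h2 : Real.log (D / d) = Real.log D - Real.log d := Real.log_div hD0.ne' hd0.ne'
      have h3 : d * Real.log (D / d) ≤ D - d := by
        have := mul_le_mul_of_nonneg_left h1 hd0.le
        rwa [show d * (D / d - 1) = D - d by field_simp] at this
      rw [h2] at h3
      have h4 : d * (-Real.log D) ≤ D * (-Real.log D) := mul_le_mul_of_nonneg_right hdD hlogD
      nlinarith
    have hT1 : ‖T z‖ ≤ ‖T c'‖ + ‖T z - T c'‖ := by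
      have := norm_add_le (T c') (T z - T c'); rwa [add_sub_cancel] at this
    have hmain : ‖T z - T c'‖ ≤ D * V + 3 / 4 * L * (D * (1 - Real.log D)) := by
      rw [← hV] at hsub
      refine hsub.trans ?_
      have e1 : d * V ≤ D * V := mul_le_mul_of_nonneg_right hdD hV0
      have e2 : d * (3 / 4 * L) * (-Real.log d) ≤ 3 / 4 * L * (D * (1 - Real.log D)) := by
        have := mul_le_mul_of_nonneg_left hlog (by positivity : (0 : ℝ) ≤ 3 / 4 * L)
        linarith [show d * (3 / 4 * L) * (-Real.log d) = 3 / 4 * L * (d * (-Real.log d)) by ring]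
      linarith
    calc ‖T z‖ ≤ ‖T c'‖ + ‖T z - T c'‖ := hT1
      _ ≤ τ + (D * V + 3 / 4 * L * (D * (1 - Real.log D))) := add_le_add hτ hmain
      _ = τ + D * (V + 3 / 4 * L * (1 - Real.log D)) := by ring
  -- reduce to the right sliver by parity
  rcases le_or_gt 0 y with hy0 | hy0
  · rw [abs_of_nonneg hy0] at hy hyb
    exact hright y hy hyb
  · rw [abs_of_neg hy0] at hy hyb
    have href : T y = (σ : ℂ) * T (-y) := by
      have := dt_outsideImage_reflect σ hvσ I hT (-y); rwa [neg_neg] at this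
    have hnorm : ‖T y‖ = ‖T (-y)‖ := by
      rw [href, norm_mul, Complex.norm_real]
      rcases hσ with h | h <;> simp [h]
    rw [hnorm]
    exact hright (-y) hy hyb

end Summit.RiemannHypothesis.RiemannHypothesis.Theorems.EvenWinsBeyondArch

end
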